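import Summits.QuantumFields.BalabanUV.T4Continuum.Support.ShellMeasurePlaquetteCubicSlice
import Summits.QuantumFields.BalabanUV.T4Continuum.Support.ShellMeasureCubicWord

/-!
# `T4Continuum.ShellMeasurePlaquetteCubicSplit` — [Balaban1985Variational] (39)∕(40) AT ONE GRID FOR THE WILSON
# PLAQUETTE PAIR: `ord₃ (plaqFunSym) = −½·τ(Y·K) + V₀′`, `‖V₀′‖ ≤ ‖τ‖·(S³ε₀∕6 + (5∕96)S⁴)` — the cubic binder of row S65 f2b
# DISCHARGED for the actual one-grid action, BCH-free (file 5 of 5 of «S65 f4»)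

Cell `pub-balaban`, sub-cell `t4`, spine estimate NE7c (node U5b), NE7c ROUND-2 crew `t4-ne7c-formalise-*`, unit
`b2b-balaban-t4-ne7c-formalise-leaf-03` gen 4; owner table `t4/b2b-balaban-t4-ne7c-p1/LEAVES-NE7c-P1.md` v2.9 row **S65 f4**
(owner GO journal l.15517, row holder leaf-02-g8 GO l.15529).  ADDITIVE: imports file 4
`ShellMeasurePlaquetteCubicSlice` and file 2 `ShellMeasureCubicWord`; modifies nothing; [folklore]; 0 `def … : Prop`, 0 sorry,
0 citation tags.

HONEST FRAMING.  Finite four-torus programme, rung (B)+1 only — NOT infinite volume, NOT a mass gap, NOT the Clay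
problem, NOT summit progress.  NE7c (`T4IndicatorShell.ShellWeightBound`) is NOT PRINTED and NOT PROVED; «NE7c ⇐ the
named binders».  Nothing of [Balaban1985Variational] is asserted: p. 283 (34) (the twisted variables «A′(b) for bonds
b ⊂ ∂p»), p. 284 (39) «V₀(A, ∂p) = ¼ i tr(DA)(p)·Σ_{b₁<b₂} i[A′(b₁), A′(b₂)] + V₀′(A, ∂p)» and (40), with (33) (the quartic
tail) and (38) (the hidden small factor `Re U₀(∂p) − 1`), are LOCATORS for the SHAPE reproduced at ONE GRID (`Lʲη = η`, sup
norms, no `η`-weights — the printed currency is row S63 (a)'s and S65 f2a's bookkeeping).  HONEST DEPENDENCY (cell,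
verbatim): continuum YM on T⁴ ⇐ BetaPertH ∧ nine spine estimates (0/9 proved); BetaPertH ⇐ (D1) ∧ (D4) ∧ CAP+tail; G-an2-4
gates asym, D1 and NE2/3/4.

THE POINT.  S62 f1∕f2∕f3 bound `locGrad (ord₃ 𝒲)` of the one-grid action by ONE Cauchy estimate in `|A|` alone — the bound
that loses `Lʲ` at the live levels (owner census gen 29; locator C-ne7cleaf02g8-1).  Print's repair is the SPLIT (39): the
only cubic term without a small factor is the curl × commutator term (integration by parts, rows S65 f3∕S66), the rest
`V₀′` is small — S65 f2b (`ShellMeasureGradientTailLevels`, p221515) proves the (98) shape for ANY local `φ_p` UNDER the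
(40)-shape cubic binder «`‖φ_p A‖ ≤ (κ∕W p)·σ³`, κ DISPLAYED».  This file DERIVES the split and the binder from the action at
one grid, for S62 f2's plaquette functional paired with its inverse word, with `τ : 𝔸 →L[ℂ] ℂ` having the TRACE PROPERTY
`τ (X * Y) = τ (Y * X)`:
* `tv U bd A i` — the four twisted variables `yᵢ` (file 3) made explicit; `mainTerm := −½·τ(Y·K)`, `Y = Σᵢ yᵢ` (print's
  `iη(DA)(p)`), `K = Σ_{i<j}[yᵢ, yⱼ]`; `V0rem := ord₃ (plaqFunSym τ U bd) A − mainTerm` (print DEFINES `V₀′` by (39) too);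
* `a₃_eq`: the cubic Taylor coefficient of file 4 is `mainTerm − ½(τ(C·(U₀(∂p) − 1)) + τ((U₀(∂p)⁻¹ − 1)·C̄))` — file 2's
  `trace_polyC_add_rev` kills every other cubic word at `U₀(∂p) = 1`;
* **`norm_V0rem_le`**: for `‖U₀(b)‖, ‖U₀(b)⁻¹‖ ≤ 1`, `‖U₀(∂p) − 1‖, ‖U₀(∂p)⁻¹ − 1‖ ≤ ε₀` (the background's plaquette
  regularity — a BINDER on `U₀`, print's (14)∕(38)) and `S ≤ 1`: `‖V₀′(A)‖ ≤ ‖τ‖·(S³·ε₀∕6 + (5∕96)·S⁴)`;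
  **`norm_V0rem_le_of_bonds`**: for `‖A(bᵢ)‖ ≤ σ`, `4σ ≤ 1`: `‖V₀′(A)‖ ≤ ‖τ‖·((32∕3)ε₀σ³ + (40∕3)σ⁴)` — S65 f2b's `κ·σ³` with
  `κ = ‖τ‖((32∕3)ε₀ + (40∕3)σ)`, small when the background is regular and the field is small: «only the first bound (32) on
  the field A alone» is used, as print says of (40).
NOT HERE (said): the `η`∕`Lʲη` currency and weights (S63 (a)∕S65 f2a bookkeeping; junction = S65 f5), the `|∇A|` norms and
(91)–(96) (S65 f3), the HD-dressing (S66), the `M_N(ℂ)`∕SU(N) instance (S63 (b) pattern; `τ = N⁻¹·tr` has the trace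
property), [dict] (node O).  No estimate of Bałaban's at a live level is discharged.
-/

noncomputable section

open scoped BigOperators
open NormedSpace Metric Set

namespace Summit.QuantumFields.BalabanUV.T4Continuum.ShellMeasurePlaquetteCubicSplit

open Literature.MathematicalPhysics.QuantumFieldTheory.Balaban1983to89
open ShellMeasureWilsonGradientTail (letter plaqWord)
open ShellMeasureCubicTaylor (expRem4 expRem4_le T3 polyC t3_expProd_of_le)
open ShellMeasureCubicWord (curl4 comm4 trace_polyC_add_rev)
open ShellMeasureLocalGradientTailJet (ord₃)
open ShellMeasurePlaquetteTwist (twistVar twists twists_nil twists_cons plaqFunSym sum_norm_reverse_neg)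
open ShellMeasurePlaquetteCubicSlice (tw twR amp amp_nonneg amp_le_four_mul coef a₃ cubicPoly norm_slice_sub_cubicPoly_le
  ord₃_plaqFunSym_eq)

variable {Λ : Type*} {𝔸 : Type*} [NormedRing 𝔸] [NormedAlgebra ℂ 𝔸] [CompleteSpace 𝔸]

/-! ## §5 THE SPLIT (39)∕(40): `ord₃ = −½·τ(Y·K) + V₀′`, `‖V₀′‖ ≤ ‖τ‖(S³ε₀∕6 + (5∕96)S⁴)` -/

section Main

/-- The background prefix holonomies `1, U₀(b₀)^{±}, U₀(b₀)^{±}U₀(b₁)^{±}, …` along the boundary. [folklore] -/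
def pre (U : Λ → 𝔸ˣ) (bd : Fin 4 → Λ × Bool) : Fin 4 → 𝔸ˣ
  | ⟨0, _⟩ => 1
  | ⟨1, _⟩ => 1 * letter U 0 (bd 0)
  | ⟨2, _⟩ => 1 * letter U 0 (bd 0) * letter U 0 (bd 1)
  | ⟨3, _⟩ => 1 * letter U 0 (bd 0) * letter U 0 (bd 1) * letter U 0 (bd 2)

/-- THE FOUR TWISTED VARIABLES `yᵢ` of the plaquette boundary (print's `iA′(bᵢ)` up to the sign of the orientation).
[folklore] -/
def tv (U : Λ → 𝔸ˣ) (bd : Fin 4 → Λ × Bool) (A : Λ → 𝔸) (i : Fin 4) : 𝔸 := twistVar U (pre U bd i) (bd i) A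

/-- The twisted word is the list of the four twisted variables. [folklore] -/
theorem tw_eq (U : Λ → 𝔸ˣ) (bd : Fin 4 → Λ × Bool) (A : Λ → 𝔸) :
    tw U bd A = [tv U bd A 0, tv U bd A 1, tv U bd A 2, tv U bd A 3] := by
  have hl : List.ofFn bd = [bd 0, bd 1, bd 2, bd 3] := by simp [List.ofFn_succ]
  simp only [tw, hl, twists_cons, twists_nil]
  rfl

/-- … and the inverse word's list is the reversed negated one. [folklore] -/
theorem twR_eq (U : Λ → 𝔸ˣ) (bd : Fin 4 → Λ × Bool) (A : Λ → 𝔸) :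
    twR U bd A = [-tv U bd A 3, -tv U bd A 2, -tv U bd A 1, -tv U bd A 0] := by
  simp [twR, tw_eq]

/-- THE MAIN (curl × commutator) TERM `−½·τ(Y·K)`, `Y = Σᵢ yᵢ`, `K = Σ_{i<j}[yᵢ, yⱼ]` — the SHAPE of [Balaban1985Variational]
(39)'s first term `¼ i tr(DA)(p)·Σ_{b₁<b₂} i[A′(b₁), A′(b₂)]` at one grid (locator only; `Y` ↔ `iη(DA)(p)`, the
`yᵢ` carry the factor `±I`). [folklore] -/
def mainTerm (τ : 𝔸 →L[ℂ] ℂ) (U : Λ → 𝔸ˣ) (bd : Fin 4 → Λ × Bool) (A : Λ → 𝔸) : ℂ :=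
  -((2 : ℂ)⁻¹ * τ (curl4 (tv U bd A 0) (tv U bd A 1) (tv U bd A 2) (tv U bd A 3)
    * comm4 (tv U bd A 0) (tv U bd A 1) (tv U bd A 2) (tv U bd A 3)))

variable [Fintype Λ]

/-- THE REMAINDER `V₀′ := ord₃ (plaqFunSym) − mainTerm` — print's `V₀′(A, ∂p)` of (39), DEFINED by the split as print does
(«where V₀′(A, ∂p) is defined by this equality»). [folklore] -/
def V0rem (τ : 𝔸 →L[ℂ] ℂ) (U : Λ → 𝔸ˣ) (bd : Fin 4 → Λ × Bool) (A : Λ → 𝔸) : ℂ :=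
  ord₃ (plaqFunSym τ U bd) A - mainTerm τ U bd A

/-- (39) as an identity: `ord₃ (plaqFunSym τ U bd) A = mainTerm + V₀′` (by definition of `V₀′`). [folklore] -/
theorem ord₃_plaqFunSym_split (τ : 𝔸 →L[ℂ] ℂ) (U : Λ → 𝔸ˣ) (bd : Fin 4 → Λ × Bool) (A : Λ → 𝔸) :
    ord₃ (plaqFunSym τ U bd) A = mainTerm τ U bd A + V0rem τ U bd A := by
  simp [V0rem]

omit [Fintype Λ] in
/-- THE CUBIC COEFFICIENT SPLITS: `a₃ = mainTerm − ½(τ(C·(U(∂p) − 1)) + τ((U(∂p)⁻¹ − 1)·C̄))` — file 2's cubic word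
algebra under the trace property of `τ`. [folklore] -/
theorem a₃_eq (τ : 𝔸 →L[ℂ] ℂ) (hτ : ∀ X Y : 𝔸, τ (X * Y) = τ (Y * X)) (U : Λ → 𝔸ˣ) (bd : Fin 4 → Λ × Bool)
    (A : Λ → 𝔸) :
    a₃ τ U bd A = mainTerm τ U bd A
      - (2 : ℂ)⁻¹ * (τ (polyC (tw U bd A) * ((plaqWord U bd 0 : 𝔸) - 1))
        + τ (((((plaqWord U bd 0)⁻¹ : 𝔸ˣ) : 𝔸) - 1) * polyC (twR U bd A))) := by
  have key := trace_polyC_add_rev (τ : 𝔸 →ₗ[ℂ] ℂ) hτ (tv U bd A 0) (tv U bd A 1) (tv U bd A 2) (tv U bd A 3)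
  simp only [ContinuousLinearMap.coe_coe] at key
  rw [a₃, coef, mainTerm, ← key, tw_eq, twR_eq]
  simp only [mul_sub, sub_mul, mul_one, one_mul, map_sub]
  ring

variable [NormOneClass 𝔸] {U : Λ → 𝔸ˣ} (hU : ∀ b, ‖(U b : 𝔸)‖ ≤ 1) (hU' : ∀ b, ‖(((U b)⁻¹ : 𝔸ˣ) : 𝔸)‖ ≤ 1)
include hU hU'

/-- **THE (40)-SHAPE BOUND ON `V₀′` (one grid).**  For `τ` with the trace property, a unit-bounded background whose
plaquette word is `ε₀`-close to `1` together with its inverse (`‖U(∂p) − 1‖, ‖U(∂p)⁻¹ − 1‖ ≤ ε₀` — print's (14)∕(38)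
background regularity, a BINDER on `U₀`), and a twisted amplitude `S = Σᵢ‖yᵢ‖ ≤ 1`:
`‖V₀′(A)‖ ≤ ‖τ‖·(S³·ε₀∕6 + (5∕96)·S⁴)` — cubic with the SMALL factor `ε₀` plus the quartic tail ((33)-type). [folklore] -/
theorem norm_V0rem_le (τ : 𝔸 →L[ℂ] ℂ) (hτ : ∀ X Y : 𝔸, τ (X * Y) = τ (Y * X)) (bd : Fin 4 → Λ × Bool) (A : Λ → 𝔸)
    {ε₀ : ℝ} (hε₀ : ‖(plaqWord U bd (0 : Λ → 𝔸) : 𝔸) - 1‖ ≤ ε₀)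
    (hε₀' : ‖(((plaqWord U bd (0 : Λ → 𝔸))⁻¹ : 𝔸ˣ) : 𝔸) - 1‖ ≤ ε₀) (hS : amp U bd A ≤ 1) :
    ‖V0rem τ U bd A‖ ≤ ‖τ‖ * (amp U bd A ^ 3 / 6 * ε₀ + 5 / 96 * amp U bd A ^ 4) := by
  have hS0 := amp_nonneg (U := U) bd A
  have hε : 0 ≤ ε₀ := (norm_nonneg _).trans hε₀
  -- the cubic polynomials of the two words are bounded by S³/6
  have hC : ‖polyC (tw U bd A)‖ ≤ amp U bd A ^ 3 / 6 := (t3_expProd_of_le (ys := tw U bd A) le_rfl).norm_cub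
  have hC' : ‖polyC (twR U bd A)‖ ≤ amp U bd A ^ 3 / 6 := by
    have h := (t3_expProd_of_le (ys := twR U bd A) (s := amp U bd A) (by rw [twR, sum_norm_reverse_neg]; rfl)).norm_cub
    exact h
  -- the quartic tail at t = 1
  have htail : ‖plaqFunSym τ U bd A - cubicPoly τ U bd A 1‖ ≤ ‖τ‖ * (5 / 96 * amp U bd A ^ 4) := by
    have h := norm_slice_sub_cubicPoly_le hU hU' τ bd A 1
    rw [one_smul, norm_one, one_mul] at h
    exact h.trans (mul_le_mul_of_nonneg_left (expRem4_le hS0 hS) (norm_nonneg _))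
  -- the ε₀-part
  have h1 : ‖τ (polyC (tw U bd A) * ((plaqWord U bd 0 : 𝔸) - 1))‖ ≤ ‖τ‖ * (amp U bd A ^ 3 / 6 * ε₀) := by
    refine (τ.le_opNorm _).trans (mul_le_mul_of_nonneg_left ?_ (norm_nonneg _))
    exact (norm_mul_le _ _).trans (mul_le_mul hC hε₀ (norm_nonneg _) (by positivity))
  have h2 : ‖τ (((((plaqWord U bd 0)⁻¹ : 𝔸ˣ) : 𝔸) - 1) * polyC (twR U bd A))‖ ≤ ‖τ‖ * (amp U bd A ^ 3 / 6 * ε₀) := by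
    refine (τ.le_opNorm _).trans (mul_le_mul_of_nonneg_left ?_ (norm_nonneg _))
    calc _ ≤ ‖(((plaqWord U bd 0)⁻¹ : 𝔸ˣ) : 𝔸) - 1‖ * ‖polyC (twR U bd A)‖ := norm_mul_le _ _
      _ ≤ ε₀ * (amp U bd A ^ 3 / 6) := mul_le_mul hε₀' hC' (norm_nonneg _) hε
      _ = amp U bd A ^ 3 / 6 * ε₀ := mul_comm _ _
  have hsplit : V0rem τ U bd A =
      -((2 : ℂ)⁻¹ * (τ (polyC (tw U bd A) * ((plaqWord U bd 0 : 𝔸) - 1))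
        + τ (((((plaqWord U bd 0)⁻¹ : 𝔸ˣ) : 𝔸) - 1) * polyC (twR U bd A))))
        + (plaqFunSym τ U bd A - cubicPoly τ U bd A 1) := by
    rw [V0rem, ord₃_plaqFunSym_eq hU hU', a₃_eq τ hτ]
    ring
  rw [hsplit]
  calc _ ≤ ‖-((2 : ℂ)⁻¹ * (τ (polyC (tw U bd A) * ((plaqWord U bd 0 : 𝔸) - 1))
          + τ (((((plaqWord U bd 0)⁻¹ : 𝔸ˣ) : 𝔸) - 1) * polyC (twR U bd A))))‖
        + ‖plaqFunSym τ U bd A - cubicPoly τ U bd A 1‖ := norm_add_le _ _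
    _ ≤ 2⁻¹ * (‖τ‖ * (amp U bd A ^ 3 / 6 * ε₀) + ‖τ‖ * (amp U bd A ^ 3 / 6 * ε₀)) + ‖τ‖ * (5 / 96 * amp U bd A ^ 4) := by
        refine add_le_add ?_ htail
        rw [norm_neg, norm_mul, norm_inv, RCLike.norm_ofNat]
        gcongr
        exact (norm_add_le _ _).trans (add_le_add h1 h2)
    _ = ‖τ‖ * (amp U bd A ^ 3 / 6 * ε₀ + 5 / 96 * amp U bd A ^ 4) := by ring

/-- **[Balaban1985Variational] (39)∕(40) AT ONE GRID, IN THE FIELD'S OWN SIZE**: if `‖A(bᵢ)‖ ≤ σ` on the four boundary bonds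
with `4σ ≤ 1`, then `ord₃ (plaqFunSym τ U bd) A = mainTerm + V₀′(A)` with
`‖V₀′(A)‖ ≤ ‖τ‖·((32∕3)·ε₀·σ³ + (40∕3)·σ⁴)` — S65 f2b's cubic binder shape `κ·σ³` with `κ = ‖τ‖·((32∕3)ε₀ + (40∕3)σ)`,
SMALL when the background plaquette is regular (`ε₀`) and the field is small (`σ`): «only the first bound (32) on the field
A alone» is used. [folklore] -/
theorem norm_V0rem_le_of_bonds (τ : 𝔸 →L[ℂ] ℂ) (hτ : ∀ X Y : 𝔸, τ (X * Y) = τ (Y * X)) (bd : Fin 4 → Λ × Bool)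
    {A : Λ → 𝔸} {ε₀ σ : ℝ} (hε₀ : ‖(plaqWord U bd (0 : Λ → 𝔸) : 𝔸) - 1‖ ≤ ε₀)
    (hε₀' : ‖(((plaqWord U bd (0 : Λ → 𝔸))⁻¹ : 𝔸ˣ) : 𝔸) - 1‖ ≤ ε₀) (hA : ∀ i, ‖A (bd i).1‖ ≤ σ) (hσ : 4 * σ ≤ 1) :
    ‖V0rem τ U bd A‖ ≤ ‖τ‖ * (32 / 3 * ε₀ * σ ^ 3 + 40 / 3 * σ ^ 4) := by
  have hS0 := amp_nonneg (U := U) bd A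
  have hS4 : amp U bd A ≤ 4 * σ := amp_le_four_mul hU hU' bd hA
  have hε : 0 ≤ ε₀ := (norm_nonneg _).trans hε₀
  have h := norm_V0rem_le hU hU' τ hτ bd A hε₀ hε₀' (hS4.trans hσ)
  refine h.trans (mul_le_mul_of_nonneg_left ?_ (norm_nonneg _))
  have h3 : amp U bd A ^ 3 ≤ (4 * σ) ^ 3 := by gcongr
  have h4 : amp U bd A ^ 4 ≤ (4 * σ) ^ 4 := by gcongr
  nlinarith

end Main

end Summit.QuantumFields.BalabanUV.T4Continuum.ShellMeasurePlaquetteCubicSplit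

end
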